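import Summits.BirchSwinnertonDyer.BirchSwinnertonDyer.Theorems.ManinLocalTwoThreeIstarTwoJValuation
import Summits.BirchSwinnertonDyer.BirchSwinnertonDyer.Theorems.ManinLocalTwoThreeVeluTwoIsogenous
import Literature.NumberTheory.EllipticCurves.ManinConstantPotMultiplicativeProofs
import Literature.NumberTheory.EllipticCurves.GlobalMinimalModelProofs
import HarnessLib

/-!
# The `X₀(2)`-Hauptmodul at a rational `2`-torsion point: `c₄·g² = 16g³ + Δ`, `A·g² = 256g³ + Δ`, and the `2`-adic classes
# `ord₂ j = 2K | 12 − K`, `ord₂ j(W/⟨T⟩) = K | 24 − 2K` (`K = ord₂ Δ_min − 3·ord₂ g`)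

Summit `BirchSwinnertonDyer`, route `ManinLocalTwoThree` (cell bsd-f2-manin), cruxes C2 `ManinOddAtFour` (stmt-BirchSwinnertonDyer-22967) and
C3 `ManinPrimeToThreeAtNine` (stmt-…-22968).  Vocabulary of an's clock law at `2` (E-an-119/121, MEMO-an §67, Sketch-an-g25): for a globally
minimal `W/ℚ` and a rational `2`-torsion abscissa `q` (`Ψ₂²_W(q − b₂/12) = 0`), `g := 3q² − c₄/48` (= an's `twoTorsionSlope W (q − b₂/12)`,
`twoTorsionSlope_eq_veluB`), `t₀ := Δ/g³` the `X₀(2)`-Hauptmodul value, `K := ord₂ Δ_min − 3·ord₂ g = ord₂ t₀` (an's `hauptK₂`), and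
`(A, B) = (720q² − 4c₄, 19008q³ − 144c₄q)` p3's `u = 1` Vélu `2`-pair (`…VeluTwoDiscriminant`).

* §1 THE TWO HAUPTMODUL IDENTITIES (polynomial identities modulo `Ψ₂²`, `linear_combination`): `c₄·g² = 16g³ + Δ` (`j = (t₀ + 16)³/t₀`) and
  `A·g² = 256g³ + Δ` (`j(W/⟨T⟩) = (t₀′ + 16)³/t₀′`, `t₀′ = 2¹²/t₀`): `c₄_mul_veluB_sq`, `veluA_mul_veluB_sq`.
* §2 THE `2`-ADIC CLASSES (E-an-121's dictionary as theorems): `padicValRat_two_j_of_hauptK` — `K < 4 ⟹ ord₂ j = 2K`, `K > 4 ⟹ ord₂ j = 12 − K`,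
  `K = 4 ⟹ j = 0 ∨ ord₂ j ≥ 8`; so potentially good at `2` forces `0 ≤ K ≤ 12` (`hauptK_nonneg_of…`, `hauptK_le_twelve_of…`), and
  `ord₂ j = 0 ⟺ K ∈ {0, 12}` on that range; `padicValRat_two_j_velu_carrier` — every carrier `T` of the pair (`k⁴c₄(T) = A`, `k⁶c₆(T) = B`) has
  `ord₂ j(T) = K` (`K < 8`), `24 − 2K` (`K > 8`), `j(T) = 0 ∨ ord₂ j(T) ≥ 8` (`K = 8`): `1 ≤ K ≤ 11 ⟹` BOTH `W` and `W/⟨T⟩` are potentially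
  supersingular at `2`.
* §3 `twelve_le_padicValRat_two_j_add_ordMinimalDiscriminant` — ADDITIVE at `2` ⟹ `ord₂ j + ord₂ Δ_min ≥ 12` (`ord₂ c₄ ≥ 4` on the Step-2 model:
  `c₄ = 16((α² + a₂)² − 6(αγ + a₄/2))` with `a₁ = 2α`, `a₃ = 2γ`); hence types `II, III, IV, I₀*, IV*` at `2` (`ord₂ Δ_min ≤ 10`) are
  potentially supersingular, and a potentially ORDINARY additive fibre at `2` has `ord₂ Δ_min ≥ 12`.
* §4 `not_veluTwoPairMinimal_and_twiceMinimal` — S-an-39's exclusivity: no pair `(A, B)` is carried both by a globally minimal curve and,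
  divided by `(2⁴, 2⁶)`, by another (the two would be `ℚ`-isomorphic globally minimal models with `c₄`'s differing by `2⁴`;
  `isGloballyMinimal_unique_holds`).

HONEST FRAMING: local/algebraic structure; the clock law E-an-119 is assembled in the sequel (modulo conductor invariance along the isogeny); C2, C3,
Manin's conjecture and BSD are not proved.  No definitions, no named facts, no sorry.  References: [SilvermanATAEC1994] IV.9.4; [SilvermanAEC2009]
III.1, VII.1, VIII.8; [DokchitserDokchitser2015LocalInvariants] Table 1.
-/

set_option linter.dupNamespace false
set_option autoImplicit false

noncomputable section

open scoped Classical

open WeierstrassCurve IsDedekindDomain IsLocalRing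
  Literature.NumberTheory.DiophantineGeometry Literature.NumberTheory.DiophantineGeometry.TateAlgorithm
  Literature.NumberTheory.DiophantineGeometry.TateAlgorithm.CharTwo
  Literature.NumberTheory.EllipticCurves
open IsDiscreteValuationRing hiding maximalIdeal

namespace Summit.BirchSwinnertonDyer.BirchSwinnertonDyer.Theorems.ManinLocalTwoThree

/-! ### §1 The two Hauptmodul identities -/

/-- **`c₄ · g² = 16 g³ + Δ`** (`g = 3q² − c₄/48`) modulo `Ψ₂²(q) = 4q³ − c₄q/12 − c₆/216 = 0`: the `X₀(2)`-relation `j·t₀ = (t₀ + 16)³`,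
`t₀ = Δ/g³`. [cite: SilvermanAEC2009, III.4 Example 4.5] -/
theorem c₄_mul_veluB_sq_eq {K : Type*} [Field K] [CharZero K] (c4 c6 q : K) (hΨ : 4 * q ^ 3 - c4 / 12 * q - c6 / 216 = 0) :
    c4 * (3 * q ^ 2 - c4 / 48) ^ 2 = 16 * (3 * q ^ 2 - c4 / 48) ^ 3 + (c4 ^ 3 - c6 ^ 2) / 1728 := by
  linear_combination (-(1 / 8 : K) * (c6 + 864 * q ^ 3 - 18 * c4 * q)) * hΨ

/-- **`A · g² = 256 g³ + Δ`** (`A = 720q² − 4c₄` the `c₄` of the `u = 1` Vélu `2`-pair): the relation `j′·t₀′ = (t₀′ + 16)³` for the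
`2`-isogenous curve, `t₀′ = 2¹²/t₀`. [cite: SilvermanAEC2009, III.4 Example 4.5] -/
theorem veluA_mul_veluB_sq_eq {K : Type*} [Field K] [CharZero K] (c4 c6 q : K) (hΨ : 4 * q ^ 3 - c4 / 12 * q - c6 / 216 = 0) :
    (720 * q ^ 2 - 4 * c4) * (3 * q ^ 2 - c4 / 48) ^ 2 = 256 * (3 * q ^ 2 - c4 / 48) ^ 3 + (c4 ^ 3 - c6 ^ 2) / 1728 := by
  linear_combination (-(1 / 8 : K) * (c6 + 864 * q ^ 3 - 18 * c4 * q)) * hΨ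

/-- Curve form: `c₄ · g² = 16 g³ + Δ(W)` at a rational `2`-torsion abscissa. [cite: SilvermanAEC2009, III.4 Example 4.5] -/
theorem c₄_mul_veluB_sq (W : WeierstrassCurve ℚ) (q : ℚ) (hq : W.Ψ₂Sq.eval (q - W.b₂ / 12) = 0) :
    W.c₄ * (3 * q ^ 2 - W.c₄ / 48) ^ 2 = 16 * (3 * q ^ 2 - W.c₄ / 48) ^ 3 + W.Δ := by
  rw [Ψ₂Sq_eval_sub_b₂_div_twelve_explicit] at hq
  have hW : W.Δ = (W.c₄ ^ 3 - W.c₆ ^ 2) / 1728 := by linear_combination W.c_relation / 1728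
  rw [hW]; exact c₄_mul_veluB_sq_eq W.c₄ W.c₆ q hq

/-- Curve form: `A · g² = 256 g³ + Δ(W)`. [cite: SilvermanAEC2009, III.4 Example 4.5] -/
theorem veluA_mul_veluB_sq (W : WeierstrassCurve ℚ) (q : ℚ) (hq : W.Ψ₂Sq.eval (q - W.b₂ / 12) = 0) :
    (720 * q ^ 2 - 4 * W.c₄) * (3 * q ^ 2 - W.c₄ / 48) ^ 2 = 256 * (3 * q ^ 2 - W.c₄ / 48) ^ 3 + W.Δ := by
  rw [Ψ₂Sq_eval_sub_b₂_div_twelve_explicit] at hq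
  have hW : W.Δ = (W.c₄ ^ 3 - W.c₆ ^ 2) / 1728 := by linear_combination W.c_relation / 1728
  rw [hW]; exact veluA_mul_veluB_sq_eq W.c₄ W.c₆ q hq

/-- an's `twoTorsionSlope W (q − b₂/12) = 3x² + (b₂/2)x + b₄/2` IS `g = 3q² − c₄/48`. [folklore] -/
theorem twoTorsionSlope_eq_veluB (W : WeierstrassCurve ℚ) (q : ℚ) :
    3 * (q - W.b₂ / 12) ^ 2 + W.b₂ / 2 * (q - W.b₂ / 12) + W.b₄ / 2 = 3 * q ^ 2 - W.c₄ / 48 := by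
  simp only [WeierstrassCurve.c₄]; ring

/-! ### §2 The `2`-adic classes of `W` and of the Vélu quotient -/

/-- `ord_p j = 3·ord_p c₄ − ord_p Δ` (`j = c₄³/Δ`), for `c₄ ≠ 0`. [folklore] -/
theorem padicValRat_j_eq (p : ℕ) [Fact p.Prime] (W : WeierstrassCurve ℚ) [W.IsElliptic] (hc₄ : W.c₄ ≠ 0) :
    padicValRat p W.j = 3 * padicValRat p W.c₄ - padicValRat p W.Δ := by
  have hΔ : W.Δ ≠ 0 := by rw [← WeierstrassCurve.coe_Δ']; exact W.Δ'.ne_zero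
  have hj : W.j = W.c₄ ^ 3 / W.Δ := by
    rw [WeierstrassCurve.j, ← WeierstrassCurve.coe_Δ', div_eq_mul_inv, mul_comm, Units.val_inv_eq_inv_val]
  rw [hj, padicValRat.div (pow_ne_zero 3 hc₄) hΔ, padicValRat.pow W.c₄]
  push_cast; ring

/-- `j = 0 ⟺ c₄ = 0`. [folklore] -/
theorem j_eq_zero_iff_c₄_eq_zero (W : WeierstrassCurve ℚ) [W.IsElliptic] : W.j = 0 ↔ W.c₄ = 0 := by
  have hΔ : W.Δ ≠ 0 := by rw [← WeierstrassCurve.coe_Δ']; exact W.Δ'.ne_zero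
  have hj : W.j = W.c₄ ^ 3 / W.Δ := by
    rw [WeierstrassCurve.j, ← WeierstrassCurve.coe_Δ', div_eq_mul_inv, mul_comm, Units.val_inv_eq_inv_val]
  rw [hj, div_eq_zero_iff, or_iff_left hΔ]
  exact ⟨fun h ↦ (pow_eq_zero_iff three_ne_zero).mp h, fun h ↦ by rw [h]; ring⟩

/-- `ord₂ (2^e · x³) = e + 3·ord₂ x` for `x ≠ 0`. [folklore] -/
theorem padicValRat_two_pow_mul_cube (e : ℕ) {x : ℚ} (hx : x ≠ 0) :
    padicValRat 2 ((2 : ℚ) ^ e * x ^ 3) = e + 3 * padicValRat 2 x := by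
  haveI : Fact (Nat.Prime 2) := ⟨Nat.prime_two⟩
  have h2v : padicValRat 2 (2 : ℚ) = 1 := by exact_mod_cast padicValRat.self (p := 2) (by norm_num)
  rw [padicValRat.mul (pow_ne_zero e two_ne_zero) (pow_ne_zero 3 hx), padicValRat.pow x, padicValRat.pow (2 : ℚ), h2v]
  push_cast; ring

/-- **The `2`-adic class of `W` from `K = ord₂ Δ_min − 3·ord₂ g`** (`c₄·g² = 16g³ + Δ`): `K < 4 ⟹ ord₂ j = 2K`; `K > 4 ⟹ ord₂ j = 12 − K`;
`K = 4 ⟹ j = 0 ∨ ord₂ j ≥ 8`. [cite: DokchitserDokchitser2015LocalInvariants, Table 1] -/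
theorem padicValRat_two_j_of_hauptK (W : WeierstrassCurve ℚ) [W.IsElliptic] [W.IsGloballyMinimal] (q : ℚ)
    (hq : W.Ψ₂Sq.eval (q - W.b₂ / 12) = 0) (K : ℤ)
    (hK : (padicValInt 2 W.minimalDiscriminantInt : ℤ) - 3 * padicValRat 2 (3 * q ^ 2 - W.c₄ / 48) = K) :
    (K < 4 → padicValRat 2 W.j = 2 * K) ∧ (4 < K → padicValRat 2 W.j = 12 - K) ∧ (K = 4 → W.j = 0 ∨ 8 ≤ padicValRat 2 W.j) := by
  haveI : Fact (Nat.Prime 2) := ⟨Nat.prime_two⟩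
  set B : ℚ := 3 * q ^ 2 - W.c₄ / 48 with hB
  have hB0 : B ≠ 0 := velu_two_B_ne_zero W q hq
  have hΔ : W.Δ ≠ 0 := by rw [← WeierstrassCurve.coe_Δ']; exact W.Δ'.ne_zero
  have hδ : padicValRat 2 W.Δ = padicValInt 2 W.minimalDiscriminantInt := by
    rw [← cast_minimalDiscriminantInt W, padicValRat.of_int]
  have hid : W.c₄ * B ^ 2 = 16 * B ^ 3 + W.Δ := c₄_mul_veluB_sq W q hq
  have h16B0 : (16 : ℚ) * B ^ 3 ≠ 0 := mul_ne_zero (by norm_num) (pow_ne_zero 3 hB0)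
  have hv16 : padicValRat 2 (16 * B ^ 3) = 4 + 3 * padicValRat 2 B := by
    rw [show (16 : ℚ) = (2 : ℚ) ^ 4 by norm_num, padicValRat_two_pow_mul_cube 4 hB0]; push_cast; ring
  -- the case `c₄ = 0`: then `16 g³ = −Δ` and `K = 4`
  by_cases hc₄ : W.c₄ = 0
  · have hsum : 16 * B ^ 3 = -W.Δ := by rw [hc₄, zero_mul] at hid; linear_combination -hid
    have hv : (4 : ℤ) + 3 * padicValRat 2 B = padicValInt 2 W.minimalDiscriminantInt := by
      rw [← hv16, hsum, padicValRat.neg, hδ]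
    have hK4 : K = 4 := by linarith
    exact ⟨fun h ↦ by omega, fun h ↦ by omega, fun _ ↦ Or.inl ((j_eq_zero_iff_c₄_eq_zero W).mpr hc₄)⟩
  -- `c₄ ≠ 0`: `ord c₄ + 2 ord g = ord (16 g³ + Δ)`
  have hsum0 : 16 * B ^ 3 + W.Δ ≠ 0 := by rw [← hid]; exact mul_ne_zero hc₄ (pow_ne_zero 2 hB0)
  have hvs : padicValRat 2 W.c₄ + 2 * padicValRat 2 B = padicValRat 2 (16 * B ^ 3 + W.Δ) := by
    rw [← hid, padicValRat.mul hc₄ (pow_ne_zero 2 hB0), padicValRat.pow B]; push_cast; ring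
  have hj := padicValRat_j_eq 2 W hc₄
  refine ⟨fun hlt ↦ ?_, fun hgt ↦ ?_, fun heq ↦ ?_⟩
  · -- `K < 4`: `ord Δ < ord (16 g³)`, the sum has `ord = ord Δ`
    have hval : padicValRat 2 W.Δ < padicValRat 2 (16 * B ^ 3) := by rw [hv16, hδ]; linarith
    have hs : padicValRat 2 (16 * B ^ 3 + W.Δ) = padicValRat 2 W.Δ := by
      rw [add_comm]; exact padicValRat.add_eq_of_lt (by rwa [add_comm]) hΔ h16B0 hval
    rw [hs, hδ] at hvs
    rw [hj, hδ]; linarith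
  · -- `K > 4`: the sum has `ord = 4 + 3 ord g`
    have hval : padicValRat 2 (16 * B ^ 3) < padicValRat 2 W.Δ := by rw [hv16, hδ]; linarith
    have hs : padicValRat 2 (16 * B ^ 3 + W.Δ) = padicValRat 2 (16 * B ^ 3) := padicValRat.add_eq_of_lt hsum0 h16B0 hΔ hval
    rw [hs, hv16] at hvs
    rw [hj, hδ]; linarith
  · -- `K = 4`: `ord` of the sum is at least `ord Δ`
    right
    have hle := padicValRat.min_le_padicValRat_add (p := 2) hsum0
    have hm : min (padicValRat 2 (16 * B ^ 3)) (padicValRat 2 W.Δ) = padicValRat 2 W.Δ := by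
      rw [min_eq_right_iff, hv16, hδ]; linarith
    rw [hm, ← hvs, hδ] at hle
    rw [hj, hδ]; linarith

/-- **Potentially good at `2` ⟹ `0 ≤ K`** (`K < 0 ⟹ ord₂ j = 2K < 0`). [cite: DokchitserDokchitser2015LocalInvariants, Table 1] -/
theorem hauptK_nonneg_of_padicValRat_j_nonneg (W : WeierstrassCurve ℚ) [W.IsElliptic] [W.IsGloballyMinimal] (q : ℚ)
    (hq : W.Ψ₂Sq.eval (q - W.b₂ / 12) = 0) (hj : 0 ≤ padicValRat 2 W.j) :
    0 ≤ (padicValInt 2 W.minimalDiscriminantInt : ℤ) - 3 * padicValRat 2 (3 * q ^ 2 - W.c₄ / 48) := by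
  obtain ⟨h, -, -⟩ := padicValRat_two_j_of_hauptK W q hq _ rfl
  by_contra hlt
  have := h (by linarith)
  linarith

/-- **Potentially good at `2` ⟹ `K ≤ 12`** (`K > 12 ⟹ ord₂ j = 12 − K < 0`). [cite: DokchitserDokchitser2015LocalInvariants, Table 1] -/
theorem hauptK_le_twelve_of_padicValRat_j_nonneg (W : WeierstrassCurve ℚ) [W.IsElliptic] [W.IsGloballyMinimal] (q : ℚ)
    (hq : W.Ψ₂Sq.eval (q - W.b₂ / 12) = 0) (hj : 0 ≤ padicValRat 2 W.j) :
    (padicValInt 2 W.minimalDiscriminantInt : ℤ) - 3 * padicValRat 2 (3 * q ^ 2 - W.c₄ / 48) ≤ 12 := by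
  obtain ⟨-, h, -⟩ := padicValRat_two_j_of_hauptK W q hq _ rfl
  by_contra hlt
  have := h (by linarith)
  linarith

/-- **`1 ≤ K ≤ 11 ⟹ W` is potentially supersingular at `2`** (`j = 0 ∨ ord₂ j > 0`). [cite: DokchitserDokchitser2015LocalInvariants, Table 1] -/
theorem potSupersingular_two_of_hauptK (W : WeierstrassCurve ℚ) [W.IsElliptic] [W.IsGloballyMinimal] (q : ℚ)
    (hq : W.Ψ₂Sq.eval (q - W.b₂ / 12) = 0)
    (h1 : 1 ≤ (padicValInt 2 W.minimalDiscriminantInt : ℤ) - 3 * padicValRat 2 (3 * q ^ 2 - W.c₄ / 48))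
    (h11 : (padicValInt 2 W.minimalDiscriminantInt : ℤ) - 3 * padicValRat 2 (3 * q ^ 2 - W.c₄ / 48) ≤ 11) :
    W.j = 0 ∨ 0 < padicValRat 2 W.j := by
  obtain ⟨hlt, hgt, heq⟩ := padicValRat_two_j_of_hauptK W q hq _ rfl
  set K := (padicValInt 2 W.minimalDiscriminantInt : ℤ) - 3 * padicValRat 2 (3 * q ^ 2 - W.c₄ / 48)
  rcases lt_trichotomy K 4 with h | h | h
  · right; rw [hlt h]; linarith
  · rcases heq h with h0 | h8
    · exact Or.inl h0
    · right; linarith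
  · right; rw [hgt h]; linarith

/-- **`ord₂ j = 0` (potentially ordinary) ⟹ `K = 0 ∨ K = 12`.** [cite: DokchitserDokchitser2015LocalInvariants, Table 1] -/
theorem hauptK_eq_zero_or_twelve_of_padicValRat_j_eq_zero (W : WeierstrassCurve ℚ) [W.IsElliptic] [W.IsGloballyMinimal] (q : ℚ)
    (hq : W.Ψ₂Sq.eval (q - W.b₂ / 12) = 0) (hj0 : W.j ≠ 0) (hj : padicValRat 2 W.j = 0) :
    (padicValInt 2 W.minimalDiscriminantInt : ℤ) - 3 * padicValRat 2 (3 * q ^ 2 - W.c₄ / 48) = 0 ∨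
      (padicValInt 2 W.minimalDiscriminantInt : ℤ) - 3 * padicValRat 2 (3 * q ^ 2 - W.c₄ / 48) = 12 := by
  obtain ⟨hlt, hgt, heq⟩ := padicValRat_two_j_of_hauptK W q hq _ rfl
  set K := (padicValInt 2 W.minimalDiscriminantInt : ℤ) - 3 * padicValRat 2 (3 * q ^ 2 - W.c₄ / 48)
  rcases lt_trichotomy K 4 with h | h | h
  · left; have := hlt h; linarith
  · rcases heq h with h0 | h8
    · exact absurd h0 hj0
    · linarith
  · right; have := hgt h; linarith

/-- **The `2`-adic class of the Vélu quotient:** every elliptic `T` with `k⁴c₄(T) = A`, `k⁶c₆(T) = B` (`k ≠ 0`; in particular the isogenous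
globally minimal carrier of `…VeluTwoIsogenous`) has `ord₂ j(T) = K` (`K < 8`), `= 24 − 2K` (`K > 8`), `j(T) = 0 ∨ ord₂ j(T) ≥ 8` (`K = 8`)
(`A·g² = 256g³ + Δ`, `Δ(T)·g³·k¹² = Δ²`). [cite: DokchitserDokchitser2015LocalInvariants, Table 1] -/
theorem padicValRat_two_j_velu_carrier (W : WeierstrassCurve ℚ) [W.IsElliptic] [W.IsGloballyMinimal] (q : ℚ)
    (hq : W.Ψ₂Sq.eval (q - W.b₂ / 12) = 0) (T : WeierstrassCurve ℚ) [T.IsElliptic] {k : ℚ} (hk : k ≠ 0)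
    (h4 : k ^ 4 * T.c₄ = 720 * q ^ 2 - 4 * W.c₄) (h6 : k ^ 6 * T.c₆ = 19008 * q ^ 3 - 144 * W.c₄ * q) (K : ℤ)
    (hK : (padicValInt 2 W.minimalDiscriminantInt : ℤ) - 3 * padicValRat 2 (3 * q ^ 2 - W.c₄ / 48) = K) :
    (K < 8 → padicValRat 2 T.j = K) ∧ (8 < K → padicValRat 2 T.j = 24 - 2 * K) ∧ (K = 8 → T.j = 0 ∨ 8 ≤ padicValRat 2 T.j) := by
  haveI : Fact (Nat.Prime 2) := ⟨Nat.prime_two⟩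
  set B : ℚ := 3 * q ^ 2 - W.c₄ / 48 with hB
  have hB0 : B ≠ 0 := velu_two_B_ne_zero W q hq
  have hΔ : W.Δ ≠ 0 := by rw [← WeierstrassCurve.coe_Δ']; exact W.Δ'.ne_zero
  have hΔT : T.Δ ≠ 0 := by rw [← WeierstrassCurve.coe_Δ']; exact T.Δ'.ne_zero
  have hδ : padicValRat 2 W.Δ = padicValInt 2 W.minimalDiscriminantInt := by
    rw [← cast_minimalDiscriminantInt W, padicValRat.of_int]
  -- `k¹² Δ(T) g³ = Δ(W)²`: the scaled model `S = ⟨k⁻¹,0,0,0⟩ • T` carries `(A, B)`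
  set S : WeierstrassCurve ℚ := (⟨(Units.mk0 k hk)⁻¹, 0, 0, 0⟩ : VariableChange ℚ) • T with hS
  have hS4 : S.c₄ = 720 * q ^ 2 - 4 * W.c₄ := by rw [← h4, hS, variableChange_c₄]; simp
  have hS6 : S.c₆ = 19008 * q ^ 3 - 144 * W.c₄ * q := by rw [← h6, hS, variableChange_c₆]; simp
  have hSΔ : S.Δ = k ^ 12 * T.Δ := by rw [hS, variableChange_Δ]; simp
  have hvS := padicValRat_velu_two_Δ 2 W q hq S hS4 hS6
  rw [hSΔ, padicValRat.mul (pow_ne_zero 12 hk) hΔT, padicValRat.pow k, hδ, ← hB] at hvS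
  push_cast at hvS
  have hidA : (720 * q ^ 2 - 4 * W.c₄) * B ^ 2 = 256 * B ^ 3 + W.Δ := veluA_mul_veluB_sq W q hq
  have h256B0 : (256 : ℚ) * B ^ 3 ≠ 0 := mul_ne_zero (by norm_num) (pow_ne_zero 3 hB0)
  have hv256 : padicValRat 2 (256 * B ^ 3) = 8 + 3 * padicValRat 2 B := by
    rw [show (256 : ℚ) = (2 : ℚ) ^ 8 by norm_num, padicValRat_two_pow_mul_cube 8 hB0]; push_cast; ring
  have hTc₄ : T.c₄ = (720 * q ^ 2 - 4 * W.c₄) / k ^ 4 := by rw [← h4]; field_simp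
  -- `A = 0`: `j(T) = 0` and `K = 8`
  by_cases hA0 : 720 * q ^ 2 - 4 * W.c₄ = 0
  · have hsum : 256 * B ^ 3 = -W.Δ := by rw [hA0, zero_mul] at hidA; linear_combination -hidA
    have hv : (8 : ℤ) + 3 * padicValRat 2 B = padicValInt 2 W.minimalDiscriminantInt := by
      rw [← hv256, hsum, padicValRat.neg, hδ]
    have hK8 : K = 8 := by linarith
    have hj0 : T.j = 0 := (j_eq_zero_iff_c₄_eq_zero T).mpr (by rw [hTc₄, hA0, zero_div])
    exact ⟨fun h ↦ by omega, fun h ↦ by omega, fun _ ↦ Or.inl hj0⟩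
  have hTc₄0 : T.c₄ ≠ 0 := by rw [hTc₄]; exact div_ne_zero hA0 (pow_ne_zero 4 hk)
  have hsum0 : 256 * B ^ 3 + W.Δ ≠ 0 := by rw [← hidA]; exact mul_ne_zero hA0 (pow_ne_zero 2 hB0)
  have hvs : padicValRat 2 (720 * q ^ 2 - 4 * W.c₄) + 2 * padicValRat 2 B = padicValRat 2 (256 * B ^ 3 + W.Δ) := by
    rw [← hidA, padicValRat.mul hA0 (pow_ne_zero 2 hB0), padicValRat.pow B]; push_cast; ring
  have hjT : padicValRat 2 T.j = 3 * padicValRat 2 (720 * q ^ 2 - 4 * W.c₄) - 12 * padicValRat 2 k - padicValRat 2 T.Δ := by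
    rw [padicValRat_j_eq 2 T hTc₄0, hTc₄, padicValRat.div hA0 (pow_ne_zero 4 hk), padicValRat.pow k]; push_cast; ring
  refine ⟨fun hlt ↦ ?_, fun hgt ↦ ?_, fun heq ↦ ?_⟩
  · have hval : padicValRat 2 W.Δ < padicValRat 2 (256 * B ^ 3) := by rw [hv256, hδ]; linarith
    have hs : padicValRat 2 (256 * B ^ 3 + W.Δ) = padicValRat 2 W.Δ := by
      rw [add_comm]; exact padicValRat.add_eq_of_lt (by rwa [add_comm]) hΔ h256B0 hval
    rw [hs, hδ] at hvs
    rw [hjT]; linarith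
  · have hval : padicValRat 2 (256 * B ^ 3) < padicValRat 2 W.Δ := by rw [hv256, hδ]; linarith
    have hs : padicValRat 2 (256 * B ^ 3 + W.Δ) = padicValRat 2 (256 * B ^ 3) := padicValRat.add_eq_of_lt hsum0 h256B0 hΔ hval
    rw [hs, hv256] at hvs
    rw [hjT]; linarith
  · right
    have hle := padicValRat.min_le_padicValRat_add (p := 2) hsum0
    have hm : min (padicValRat 2 (256 * B ^ 3)) (padicValRat 2 W.Δ) = padicValRat 2 W.Δ := by
      rw [min_eq_right_iff, hv256, hδ]; linarith
    rw [hm, ← hvs, hδ] at hle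
    rw [hjT]; linarith

/-- **`1 ≤ K ≤ 11 ⟹` every carrier of the Vélu `2`-pair is potentially supersingular at `2`.** [cite: DokchitserDokchitser2015LocalInvariants, Table 1] -/
theorem potSupersingular_two_velu_carrier (W : WeierstrassCurve ℚ) [W.IsElliptic] [W.IsGloballyMinimal] (q : ℚ)
    (hq : W.Ψ₂Sq.eval (q - W.b₂ / 12) = 0) (T : WeierstrassCurve ℚ) [T.IsElliptic] {k : ℚ} (hk : k ≠ 0)
    (h4 : k ^ 4 * T.c₄ = 720 * q ^ 2 - 4 * W.c₄) (h6 : k ^ 6 * T.c₆ = 19008 * q ^ 3 - 144 * W.c₄ * q)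
    (h1 : 1 ≤ (padicValInt 2 W.minimalDiscriminantInt : ℤ) - 3 * padicValRat 2 (3 * q ^ 2 - W.c₄ / 48))
    (h11 : (padicValInt 2 W.minimalDiscriminantInt : ℤ) - 3 * padicValRat 2 (3 * q ^ 2 - W.c₄ / 48) ≤ 11) :
    T.j = 0 ∨ 0 < padicValRat 2 T.j := by
  obtain ⟨hlt, hgt, heq⟩ := padicValRat_two_j_velu_carrier W q hq T hk h4 h6 _ rfl
  set K := (padicValInt 2 W.minimalDiscriminantInt : ℤ) - 3 * padicValRat 2 (3 * q ^ 2 - W.c₄ / 48)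
  rcases lt_trichotomy K 8 with h | h | h
  · right; rw [hlt h]; linarith
  · rcases heq h with h0 | h8
    · exact Or.inl h0
    · right; linarith
  · right; rw [hgt h]; linarith

/-- **`K ∈ {0, 12} ⟹` every carrier of the Vélu `2`-pair has `ord₂ j = 0` and `j ≠ 0`.** [cite: DokchitserDokchitser2015LocalInvariants, Table 1] -/
theorem padicValRat_two_j_velu_carrier_eq_zero (W : WeierstrassCurve ℚ) [W.IsElliptic] [W.IsGloballyMinimal] (q : ℚ)
    (hq : W.Ψ₂Sq.eval (q - W.b₂ / 12) = 0) (T : WeierstrassCurve ℚ) [T.IsElliptic] {k : ℚ} (hk : k ≠ 0)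
    (h4 : k ^ 4 * T.c₄ = 720 * q ^ 2 - 4 * W.c₄) (h6 : k ^ 6 * T.c₆ = 19008 * q ^ 3 - 144 * W.c₄ * q)
    (hK : (padicValInt 2 W.minimalDiscriminantInt : ℤ) - 3 * padicValRat 2 (3 * q ^ 2 - W.c₄ / 48) = 0 ∨
      (padicValInt 2 W.minimalDiscriminantInt : ℤ) - 3 * padicValRat 2 (3 * q ^ 2 - W.c₄ / 48) = 12) :
    padicValRat 2 T.j = 0 ∧ T.j ≠ 0 := by
  haveI : Fact (Nat.Prime 2) := ⟨Nat.prime_two⟩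
  have hB0 : (3 * q ^ 2 - W.c₄ / 48) ≠ 0 := velu_two_B_ne_zero W q hq
  -- `j(T) ≠ 0`: otherwise `A = 0`, `256 g³ = −Δ`, `K = 8`
  have hjne : T.j ≠ 0 := by
    intro hj0
    have hTc₄ : T.c₄ = 0 := (j_eq_zero_iff_c₄_eq_zero T).mp hj0
    have hA0 : 720 * q ^ 2 - 4 * W.c₄ = 0 := by rw [← h4, hTc₄, mul_zero]
    have hidA := veluA_mul_veluB_sq W q hq
    rw [hA0, zero_mul] at hidA
    have hsum : 256 * (3 * q ^ 2 - W.c₄ / 48) ^ 3 = -W.Δ := by linear_combination -hidA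
    have hδ : padicValRat 2 W.Δ = padicValInt 2 W.minimalDiscriminantInt := by
      rw [← cast_minimalDiscriminantInt W, padicValRat.of_int]
    have hv256 : padicValRat 2 (256 * (3 * q ^ 2 - W.c₄ / 48) ^ 3) = 8 + 3 * padicValRat 2 (3 * q ^ 2 - W.c₄ / 48) := by
      rw [show (256 : ℚ) = (2 : ℚ) ^ 8 by norm_num, padicValRat_two_pow_mul_cube 8 hB0]; push_cast; ring
    rw [hsum, padicValRat.neg, hδ] at hv256
    rcases hK with h | h <;> linarith
  refine ⟨?_, hjne⟩
  rcases hK with h | h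
  · obtain ⟨hlt, -, -⟩ := padicValRat_two_j_velu_carrier W q hq T hk h4 h6 _ h
    have := hlt (by norm_num); simpa using this
  · obtain ⟨-, hgt, -⟩ := padicValRat_two_j_velu_carrier W q hq T hk h4 h6 _ h
    have := hgt (by norm_num); norm_num at this; exact this

end Summit.BirchSwinnertonDyer.BirchSwinnertonDyer.Theorems.ManinLocalTwoThree

end
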